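import Summits.KontsevichZagierPeriods.KontsevichZagierPeriods.Theorems.PentagonInKZ.Negative.Tightness
import Literature.NumberTheory.Transcendental.AssociatorsBaseChange
import Literature.NumberTheory.Transcendental.MZVShuffleRegularisationProofs

/-!
# `PentagonInKZ` — negative lane, §16a–b: the weight-3 SHAPE of `Φ_χ` in every realisation

Standing adversary (cdisprove seat, generation 3) on the crux `PentagonInKZ`
(stmt-KontsevichZagierPeriods-11348), continuing `Negative/{EvalInstance,LowWeight,Tightness}.lean`.

* §16a **Linear shuffle identities with no hypothesis on `χ`**: IKZ's regularisation `reg_ш` is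
  multiplicative (`ShuffleAlgebra.reg_mul`) and kills letters, so `Σ_{w ∈ a ш v} reg_ш(w) = 0`
  coefficientwise (`sum_shuffleReg_letter_apply`) and hence `Σ_{w ∈ a ш v} Φ_χ(w) = 0` for the
  crux series in EVERY additive `χ` (`sum_cruxSeries_shuffle_letter`).
* §16b **All eight weight-3 coefficients of `Φ_χ`** in every realisation:
  `c_{xxx} = c_{yyy} = 0`, `c_{xxy} = -z₃`, `c_{xyx} = 2z₃`, `c_{yxx} = -z₃`, `c_{xyy} = z₂₁`,
  `c_{yxy} = -2z₂₁`, `c_{yyx} = z₂₁` (`zₛ = χ(Z s)`), i.e. `Φ_χ ≡ 1 + c[x,y] + p[x,[x,y]] + q[[x,y],y]`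
  modulo weight 4 with `c = -z₂`, `p = -z₃`, `q = z₂₁` — a Lie exponential to weight 3 with NO
  group-likeness hypothesis; and the substitution formula `evalTrunc_three_of_shape`.
  Used by `Negative/WeightThreeTightness.lean` (level-3 pentagon ⟺ `(q + p)·D[U] = 0`).
-/

noncomputable section

open Literature.NumberTheory.Transcendental

namespace Summit.KontsevichZagierPeriods.FurushoPentagon.PentagonInKZNegative

open Summit.KontsevichZagierPeriods.KontsevichZagierPeriods.Theses.FurushoPentagon (PentagonInKZ)

/-! ## §16a The regularised weight-3 coefficients in EVERY realisation (via `reg` multiplicative) -/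

section ShuffleLetter

/-- `reg` kills one-letter words (as elements of the completed shuffle algebra). [cite: IharaKanekoZagier2006, §3] -/
theorem reg_singleton (a : Bool) : ShuffleAlgebra.reg [a] = 0 := by
  refine DFunLike.ext _ _ fun v => ?_
  rw [← ShuffleAlgebra.shuffleReg_apply, ShuffleAlgebra.zero_apply]
  cases a
  · rw [MZV.shuffleReg_x]; rfl
  · rw [MZV.shuffleReg_y]; rfl

/-- Evaluation of a list sum in the completed shuffle algebra. [folklore] -/
theorem shuffleAlgebra_list_sum_apply (L : List (ShuffleAlgebra Bool ℚ)) (v : List Bool) :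
    L.sum v = (L.map fun F => F v).sum := by
  induction L with
  | nil => rfl
  | cons F L ih => rw [List.sum_cons, List.map_cons, List.sum_cons, ShuffleAlgebra.add_apply, ih]

/-- **`Σ_{w ∈ a ш v} reg_ш(w) = 0` coefficientwise** (`reg` is multiplicative and kills letters).
[cite: IharaKanekoZagier2006, §3 Prop. 1] -/
theorem sum_shuffleReg_letter_apply (a : Bool) (v r : List Bool) :
    ((MZV.shuffleWord [a] v).map fun w => MZV.shuffleReg w r).sum = 0 := by
  have h := congrArg (fun F : ShuffleAlgebra Bool ℚ => F r) (ShuffleAlgebra.reg_mul [a] v)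
  simp only [reg_singleton, zero_mul, ShuffleAlgebra.zero_apply, shuffleAlgebra_list_sum_apply,
    List.map_map] at h
  rw [← h]
  congr 1
  refine List.map_congr_left fun w _ => ?_
  simp [ShuffleAlgebra.shuffleReg_apply]

variable {R : Type} [CommRing R] [Algebra ℚ R] (χ : KZ.FormalRep →+ R) (Z : List ℕ → KZ.FormalRep)

/-- The sign-less coefficient functional of the crux series. [folklore] -/
theorem cruxSeries_eq_sum (W : List Bool) :
    cruxSeries R χ Z W = (-1 : R) ^ (W.count true) *
      (MZV.shuffleReg W).sum (fun v a => a • (if MZV.IsConvergentWord v then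
        χ (Z (MZV.ofBinaryWord v)) else (0 : R))) := rfl

/-- **Linear shuffle identities of the crux series**: for a letter `a` and a word `v`, if all
words of `a ш v` have the same number `n` of `y`'s then `Σ_{w ∈ a ш v} Φ_χ(w) = 0` — in EVERY
realisation, with no hypothesis on `χ` (pure regularisation algebra). [cite: IharaKanekoZagier2006, §3 Prop. 1] -/
theorem sum_cruxSeries_shuffle_letter (a : Bool) (v : List Bool) (n : ℕ)
    (hn : ∀ w ∈ MZV.shuffleWord [a] v, w.count true = n) :
    ((MZV.shuffleWord [a] v).map (cruxSeries R χ Z)).sum = 0 := by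
  set g : List Bool → ℚ → R := fun v a => a • (if MZV.IsConvergentWord v then
        χ (Z (MZV.ofBinaryWord v)) else (0 : R)) with hg
  have hlin : ∀ L : List (List Bool), (∀ w ∈ L, w.count true = n) →
      (L.map (cruxSeries R χ Z)).sum = (-1 : R) ^ n * ((L.map MZV.shuffleReg).sum).sum g := by
    intro L hL
    induction L with
    | nil => simp
    | cons w L ih =>
      have hw : w.count true = n := hL w List.mem_cons_self
      have ih' := ih (fun w' hw' => hL w' (List.mem_cons_of_mem _ hw'))
      rw [List.map_cons, List.sum_cons, List.map_cons, List.sum_cons,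
        Finsupp.sum_add_index' (by simp [hg]) (by intros; simp only [hg, add_smul]), mul_add, ih',
        cruxSeries_eq_sum, hw]
  rw [hlin _ hn]
  have h0 : ((MZV.shuffleWord [a] v).map MZV.shuffleReg).sum = 0 := by
    refine Finsupp.ext fun r => ?_
    rw [Finsupp.zero_apply, MZV.finsupp_list_sum_apply, List.map_map]
    simpa [Function.comp_def] using sum_shuffleReg_letter_apply a v r
  rw [h0, Finsupp.sum_zero_index, mul_zero]

end ShuffleLetter

section CoeffThree

variable {R : Type} [CommRing R] [Algebra ℚ R] (χ : KZ.FormalRep →+ R) (Z : List ℕ → KZ.FormalRep)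

/-- `Φ_χ(X₀X₁X₀) = 2χ⟦ζ(3)⟧` (from `x ш xy = 2xxy + xyx`). [cite: IharaKanekoZagier2006, §3] -/
theorem cruxSeries_xyx : cruxSeries R χ Z [false, true, false] = 2 * χ (Z [3]) := by
  have h := sum_cruxSeries_shuffle_letter χ Z false [false, true] 1 (by decide)
  have hw : MZV.shuffleWord [false] [false, true] =
      [[false, false, true], [false, false, true], [false, true, false]] := by decide
  rw [hw] at h
  simp only [List.map_cons, List.map_nil, List.sum_cons, List.sum_nil, add_zero,
    cruxSeries_xxy] at h
  linear_combination h

/-- `Φ_χ(X₁X₀X₀) = -χ⟦ζ(3)⟧` (from `x ш yx = xyx + 2yxx`). [cite: IharaKanekoZagier2006, §3] -/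
theorem cruxSeries_yxx : cruxSeries R χ Z [true, false, false] = -χ (Z [3]) := by
  have h := sum_cruxSeries_shuffle_letter χ Z false [true, false] 1 (by decide)
  have hw : MZV.shuffleWord [false] [true, false] =
      [[false, true, false], [true, false, false], [true, false, false]] := by decide
  rw [hw] at h
  simp only [List.map_cons, List.map_nil, List.sum_cons, List.sum_nil, add_zero,
    cruxSeries_xyx] at h
  have hu := NCSeries.isUnit_natCast_of_ne_zero (S := R) (n := 2) (by norm_num)
  rw [Nat.cast_ofNat] at hu
  have h2 : (2 : R) * (cruxSeries R χ Z [true, false, false] + χ (Z [3])) = 0 := by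
    linear_combination h
  exact eq_neg_of_add_eq_zero_left (hu.mul_right_eq_zero.mp h2)

/-- `Φ_χ(X₀X₀X₀) = 0` (from `x ш xx = 3xxx`). [cite: IharaKanekoZagier2006, §3] -/
theorem cruxSeries_xxx : cruxSeries R χ Z [false, false, false] = 0 := by
  have h := sum_cruxSeries_shuffle_letter χ Z false [false, false] 0 (by decide)
  have hw : MZV.shuffleWord [false] [false, false] =
      [[false, false, false], [false, false, false], [false, false, false]] := by decide
  rw [hw] at h
  simp only [List.map_cons, List.map_nil, List.sum_cons, List.sum_nil, add_zero] at h
  have hu := NCSeries.isUnit_natCast_of_ne_zero (S := R) (n := 3) (by norm_num)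
  rw [Nat.cast_ofNat] at hu
  have h3 : (3 : R) * cruxSeries R χ Z [false, false, false] = 0 := by linear_combination h
  exact hu.mul_right_eq_zero.mp h3

/-- `Φ_χ(X₁X₁X₁) = 0` (from `y ш yy = 3yyy`). [cite: IharaKanekoZagier2006, §3] -/
theorem cruxSeries_yyy : cruxSeries R χ Z [true, true, true] = 0 := by
  have h := sum_cruxSeries_shuffle_letter χ Z true [true, true] 3 (by decide)
  have hw : MZV.shuffleWord [true] [true, true] =
      [[true, true, true], [true, true, true], [true, true, true]] := by decide
  rw [hw] at h
  simp only [List.map_cons, List.map_nil, List.sum_cons, List.sum_nil, add_zero] at h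
  have hu := NCSeries.isUnit_natCast_of_ne_zero (S := R) (n := 3) (by norm_num)
  rw [Nat.cast_ofNat] at hu
  have h3 : (3 : R) * cruxSeries R χ Z [true, true, true] = 0 := by linear_combination h
  exact hu.mul_right_eq_zero.mp h3

/-- `Φ_χ(X₁X₀X₁) = -2χ⟦ζ(2,1)⟧` (from `y ш xy = yxy + 2xyy`). [cite: IharaKanekoZagier2006, §3] -/
theorem cruxSeries_yxy : cruxSeries R χ Z [true, false, true] = -2 * χ (Z [2, 1]) := by
  have h := sum_cruxSeries_shuffle_letter χ Z true [false, true] 2 (by decide)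
  have hw : MZV.shuffleWord [true] [false, true] =
      [[true, false, true], [false, true, true], [false, true, true]] := by decide
  rw [hw] at h
  simp only [List.map_cons, List.map_nil, List.sum_cons, List.sum_nil, add_zero,
    cruxSeries_xyy] at h
  linear_combination h

/-- `Φ_χ(X₁X₁X₀) = χ⟦ζ(2,1)⟧` (from `y ш yx = 2yyx + yxy`). [cite: IharaKanekoZagier2006, §3] -/
theorem cruxSeries_yyx : cruxSeries R χ Z [true, true, false] = χ (Z [2, 1]) := by
  have h := sum_cruxSeries_shuffle_letter χ Z true [true, false] 2 (by decide)
  have hw : MZV.shuffleWord [true] [true, false] =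
      [[true, true, false], [true, true, false], [true, false, true]] := by decide
  rw [hw] at h
  simp only [List.map_cons, List.map_nil, List.sum_cons, List.sum_nil, add_zero,
    cruxSeries_yxy] at h
  have hu := NCSeries.isUnit_natCast_of_ne_zero (S := R) (n := 2) (by norm_num)
  rw [Nat.cast_ofNat] at hu
  have h2 : (2 : R) * (cruxSeries R χ Z [true, true, false] - χ (Z [2, 1])) = 0 := by
    linear_combination h
  exact sub_eq_zero.mp (hu.mul_right_eq_zero.mp h2)

end CoeffThree

/-! ## §16b `φ(a,b)` in weight `≤ 3` for a series of Lie shape -/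

section ShapeThree

variable {k : Type} [CommRing k]

/-- **`φ(a,b) = 1 + c[a,b] + p[a,[a,b]] + q[[a,b],b]` in weight `≤ 3`** for a series of Lie shape
in weight `≤ 3`: `c = c_{xy}`, `p = c_{xxy}`, `q = c_{xyy}`, `c_{xyx} = -2p`, `c_{yxx} = p`,
`c_{yxy} = -2q`, `c_{yyx} = q`, `c_{xxx} = c_{yyy} = 0` (and the weight-`≤ 2` shape). [folklore] -/
theorem evalTrunc_three_of_shape {φ : NCSeries Bool k} (hφ : φ [] = 1) (h0 : φ [false] = 0)
    (h1 : φ [true] = 0) (hff : φ [false, false] = 0) (htt : φ [true, true] = 0)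
    (htf : φ [true, false] = -φ [false, true]) (hfff : φ [false, false, false] = 0)
    (httt : φ [true, true, true] = 0) (hftf : φ [false, true, false] = -2 * φ [false, false, true])
    (htff : φ [true, false, false] = φ [false, false, true])
    (htft : φ [true, false, true] = -2 * φ [false, true, true])
    (httf : φ [true, true, false] = φ [false, true, true])
    {A : Type} [Ring A] [Algebra k A] (a b : A) :
    NCSeries.evalTrunc 3 (NCSeries.bsub a b) φ = 1 + φ [false, true] • (a * b - b * a) +
      φ [false, false, true] • (a * a * b - a * b * a - a * b * a + b * a * a) +
      φ [false, true, true] • (a * b * b - b * a * b - b * a * b + b * b * a) := by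
  rw [NCSeries.evalTrunc_three_eq, evalTrunc_two_of_shape hφ h0 h1 hff htt htf]
  simp only [Fintype.sum_bool, NCSeries.bsub_false, NCSeries.bsub_true, hfff, httt, hftf, htff,
    htft, httf, zero_smul, add_zero, zero_add]
  module

end ShapeThree


end Summit.KontsevichZagierPeriods.FurushoPentagon.PentagonInKZNegative
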